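import Summits.QuantumFields.YangMills.Theorems.UnitScaleGibbsTestFieldSU2Dressing
import Summits.QuantumFields.YangMills.Theorems.UnitScaleGibbsTemporalGaugePrimitiveTorus
import HarnessLib

/-!
# `UnitScaleGibbsTestFieldSU2DressingPush` — `stub_linTest`'s rows R2∕R3∕R5∕R6 for the DRESSED PUSH of a `ℤ^d` test field, read in `ℤ^d` currency
# (LINE 28 «GrossTransfer»; FILE 2 of the dressing dictionary: the `castSite` push of ✓`UnitScaleGibbsTemporalGaugePrimitiveTorus` × FILE 1)

Cell `ym3-torus` (YM ladder rung R3 = continuum SU(2) Yang–Mills on every three-torus — a RUNG, NOT d = 4, NOT infinite volume, NOT a mass gap, NOT the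
Clay problem), crux of record `UnitScaleTilt.HistoryTailL` (stmt-QuantumFields-19936); LINE 28 «GrossTransfer» registered on stmt-QuantumFields-23083;
width seat `ym-ust-19936-w5` gen 17.  FILE 1 ✓`UnitScaleGibbsTestFieldSU2Dressing` dresses ANY real torus bond function `u⁰` by `u_α b := (u⁰ b : ℂ) • τ_α`
and turns the skeleton's Frobenius rows R5∕R6 into `2·Σ (du⁰)²`, `2·Σ (u⁰)²`.  THIS FILE reads those scalar sums, for `u⁰` a PUSH through `castSite` of a
`ℤ^d` bond field `a` supported with margin 1 in a NON-WRAPPING box (`hi κ − lo κ < sitesPerDir j`; the two reading rows of ✓`exists_push`), as sums over the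
INTEGER box `Π_i [lo_i, hi_i]` — the currency of KNIT-D ✓`UnitScaleGibbsTruncatedPotentialEnergyMass` (rows for arbitrary finite `B ⊆ ℤ³`, curl letter
`(a(z+e_μ,ν) − a(z,ν)) − (a(z+e_ν,μ) − a(z,μ))`):

* `push_support_margin_of_margin1`, `curl_push_eq_zero_of_not_mem'` (the margin-1 rows of a push from the scalar's margin-1 row alone — no gauge clause);
* ★`sum_sq_push_eq_sum_box` (`Σ_b (A b)² = Σ_{x ∈ Π[lo,hi]} Σ_μ (a x μ)²`), ★`curl_push_eq_curlZ` (the curl dictionary on the WHOLE integer box: plaquettes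
  sticking out of the box vanish on both sides by the margin row), ★`sum_curl_push_mul_eq_sum_box` (KNIT-PLAN P3∕P5's torus ↔ `ℤ³` dictionary
  `Σ_p (dA)_p·G p = Σ_{z,μ<ν} (curl a)(z,μ,ν)·G⟨castSite z,μ,ν⟩` for EVERY `G`), ★`sum_sq_curl_push_eq_sum_box`, `sum_subtypeLT_le_sum_sum`
  (`Σ_{μ<ν} f ≤ Σ_μ Σ_ν f`, `f ≥ 0`, to meet KNIT-D's all-ordered-pairs rows);
* ★★★`exists_dressed_push`: from T-PRIM's margin row (`a x μ ≠ 0 → μ ≠ 0 ∧ lo + 1 ≤ x ∧ x + e_μ + 1 ≤ hi ∧ lo₀ + 2 ≤ x₀`) a scalar `u⁰` and its dressing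
  `u : Fin 3 → PBond P j → M₂(ℂ)` with: the definitional row, the two reading rows, R2 VERBATIM, R3 VERBATIM (`lowPart` clause included,
  ✓`push_support_of_margin`), the box-curl ∕ off-box-curl rows of `u⁰`, R6 and R5 as `ℤ^d` IDENTITIES (factor `2 = ‖iσ_α‖_F²`), and the pairing reindexing.

HONEST SCOPE.  Finite-sum bookkeeping over my own push letters; proves no stub and closes no item.  Nothing of `stub_linTest`, «ShallowFluxSecondMomentL»,
(Q), 23083∕23133∕23134, K1, `stub_pinnedStep`∕`stub_unitEnvelope` or `HistoryTailL` is proved.  YM₃ on T³ is rung R3 — NOT d = 4, NOT a mass gap, NOT Clay.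
References: T. Bałaban, CMP **95** (1984) 17–40, (1.10) p. 19 [Balaban1984PropagatorsI]; CMP **98** (1985) 17–51, (5) p. 18 [Balaban1985Averaging];
L. Gross, CMP **92** (1983) 137–162, Thm 2.2 [GrossCMP1983].
-/

set_option autoImplicit false

noncomputable section

open scoped BigOperators Matrix
open Complex Finset
open Literature.MathematicalPhysics.QuantumFieldTheory.Balaban1983to89
open Literature.MathematicalPhysics.QuantumFieldTheory.Balaban1983to89.B4Eq19LatticeOperators (Zd unitVec)
open Literature.MathematicalPhysics.QuantumFieldTheory.Balaban1983to89.T4AxialGaugeSmallField (castSite castSite_add_e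
  castSite_injOn_box boxPlaqs boxBonds)
open Literature.MathematicalPhysics.QuantumFieldTheory.Balaban1983to89.B7Prop1Explicit (e e_apply)
open Literature.MathematicalPhysics.QuantumFieldTheory.Balaban1983to89.B8Lemma1NonAbelian (lowPart e_nonneg)
open Literature.MathematicalPhysics.QuantumFieldTheory.Balaban1983to89.B10Eq18SigmaSU2 (pauli)
open Summit.QuantumFields.YangMills.Theorems.UnitScaleGibbsActionDerivativeSlotCalculus (slotBond)
open Summit.QuantumFields.YangMills.Theorems.UnitScaleGibbsNormalEquationNetFlux (curl_support_of_margin)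
open Summit.QuantumFields.YangMills.Theorems.UnitScaleGibbsTemporalGaugePrimitiveTorus (exists_push curl_push_of_box
  push_support_of_margin sum_pbond_eq_sum_box sum_plaq_eq_sum_box e_eq_unitVec le_of_add_e_le)
open Summit.QuantumFields.YangMills.Theorems.UnitScaleGibbsTestFieldSU2Dressing (dress_skew_traceless ne_zero_of_dress_ne_zero
  sum_norm_sq_dress sum_norm_sq_curl_dress)

namespace Summit.QuantumFields.YangMills.Theorems.UnitScaleGibbsTestFieldSU2DressingPush

/-! ## §3 `ℤ^d` currency through the `castSite` push -/

section Push

open scoped Matrix.Norms.Frobenius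

variable {P : Params} {j : ℕ}

/-- `Σ_{μ<ν} f(μ,ν) ≤ Σ_μ Σ_ν f(μ,ν)` for `f ≥ 0` (to meet KNIT-D's all-ordered-pairs rows). [folklore] -/
theorem sum_subtypeLT_le_sum_sum (f : Fin P.d → Fin P.d → ℝ) (hf : ∀ μ ν, 0 ≤ f μ ν) :
    ∑ q : {q : Fin P.d × Fin P.d // q.1 < q.2}, f q.1.1 q.1.2 ≤ ∑ μ : Fin P.d, ∑ ν : Fin P.d, f μ ν := by
  classical
  rw [← Finset.sum_product' Finset.univ Finset.univ (fun μ ν => f μ ν)]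
  have h := Finset.sum_le_sum_of_subset_of_nonneg
    (f := fun q : Fin P.d × Fin P.d => f q.1 q.2)
    (Finset.subset_univ ((Finset.univ : Finset {q : Fin P.d × Fin P.d // q.1 < q.2}).map (Function.Embedding.subtype _)))
    (fun q _ _ => hf q.1 q.2)
  rw [Finset.sum_map] at h
  simpa [Finset.univ_product_univ] using h

/-- If `μ ≠ ν`, `z ≤ y` and `y + 1 ≤ hi`, then `z + e_μ + e_ν ≤ hi`. [folklore] -/
theorem add_e_add_e_le_of_le {z y hi : Fin P.d → ℤ} {μ ν : Fin P.d} (hμν : μ ≠ ν) (hzy : z ≤ y) (hy : y + 1 ≤ hi) :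
    z + e μ + e ν ≤ hi := by
  intro i
  have h1 : z i ≤ y i := hzy i
  have h2 : y i + 1 ≤ hi i := hy i
  have hsum : (e μ : Fin P.d → ℤ) i + (e ν : Fin P.d → ℤ) i ≤ 1 := by
    rw [e_apply, e_apply]
    by_cases hiμ : i = μ
    · rw [if_pos hiμ, if_neg (fun hiν => hμν (hiμ.symm.trans hiν))]
      norm_num
    · rw [if_neg hiμ]
      split_ifs <;> norm_num
  show z i + (e μ : Fin P.d → ℤ) i + (e ν : Fin P.d → ℤ) i ≤ hi i
  omega

/-- **The margin-1 row of a push, from the scalar's margin-1 row** (no gauge clauses): if `a x μ ≠ 0 → lo + 1 ≤ x ∧ x + e_μ + 1 ≤ hi` then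
`A b ≠ 0 → ∃ x, lo + 1 ≤ x ∧ x + e b.dir + 1 ≤ hi ∧ b.src = castSite x`. [cite: Balaban1984PropagatorsI, (1.10) p.19] -/
theorem push_support_margin_of_margin1 {lo hi : Fin P.d → ℤ} (a : Zd P.d → Fin P.d → ℝ)
    (ha1 : ∀ x μ, a x μ ≠ 0 → lo + 1 ≤ x ∧ x + unitVec μ + 1 ≤ hi)
    (A : PBond P j → ℝ)
    (hA : ∀ (x : Fin P.d → ℤ) (μ : Fin P.d), lo ≤ x → x + e μ ≤ hi → A ⟨castSite x, μ⟩ = a x μ)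
    (hA0 : ∀ b : PBond P j, (¬ ∃ y : Fin P.d → ℤ, lo ≤ y ∧ y + e b.dir ≤ hi ∧ b.src = castSite y) → A b = 0)
    (b : PBond P j) (hb : A b ≠ 0) :
    ∃ x : Fin P.d → ℤ, lo + 1 ≤ x ∧ x + e b.dir + 1 ≤ hi ∧ b.src = castSite x := by
  by_cases h : ∃ y : Fin P.d → ℤ, lo ≤ y ∧ y + e b.dir ≤ hi ∧ b.src = castSite y
  · obtain ⟨y, hy, hyb, hsrc⟩ := h
    have hbeq : b = ⟨castSite y, b.dir⟩ := by
      cases b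
      simp only at hsrc
      rw [hsrc]
    have hval : A b = a y b.dir := by
      conv_lhs => rw [hbeq]
      exact hA y b.dir hy hyb
    rw [hval] at hb
    obtain ⟨h1, h2⟩ := ha1 _ _ hb
    refine ⟨y, h1, ?_, hsrc⟩
    rw [e_eq_unitVec]; exact h2
  · exact absurd (hA0 b h) hb

/-- Off `boxPlaqs lo hi` the `slotBond` curl of a margin-1 push vanishes (✓`curl_support_of_margin`, contrapositive). [folklore] -/
theorem curl_push_eq_zero_of_not_mem' {lo hi : Fin P.d → ℤ} (a : Zd P.d → Fin P.d → ℝ)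
    (ha1 : ∀ x μ, a x μ ≠ 0 → lo + 1 ≤ x ∧ x + unitVec μ + 1 ≤ hi)
    (A : PBond P j → ℝ)
    (hA : ∀ (x : Fin P.d → ℤ) (μ : Fin P.d), lo ≤ x → x + e μ ≤ hi → A ⟨castSite x, μ⟩ = a x μ)
    (hA0 : ∀ b : PBond P j, (¬ ∃ y : Fin P.d → ℤ, lo ≤ y ∧ y + e b.dir ≤ hi ∧ b.src = castSite y) → A b = 0)
    (p : Plaq P j) (hp : p ∉ boxPlaqs lo hi) :
    A (slotBond p 0) + A (slotBond p 1) - A (slotBond p 2) - A (slotBond p 3) = 0 := by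
  by_contra hne
  exact hp (curl_support_of_margin A (push_support_margin_of_margin1 a ha1 A hA hA0) p hne)

/-- Membership in the integer box `Π_i [lo_i, hi_i]` as a `Fintype.piFinset`. [folklore] -/
theorem mem_piFinset_Icc_iff {lo hi : Fin P.d → ℤ} (x : Fin P.d → ℤ) :
    x ∈ Fintype.piFinset (fun i => Finset.Icc (lo i) (hi i)) ↔ lo ≤ x ∧ x ≤ hi := by
  simp only [Fintype.mem_piFinset, Finset.mem_Icc]
  exact ⟨fun h => ⟨fun i => (h i).1, fun i => (h i).2⟩, fun h i => ⟨h.1 i, h.2 i⟩⟩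

/-- A push reads `0` at `⟨castSite x, μ⟩` when `x` is in the box but `x + e_μ` is not (injectivity of `castSite` on the box). [folklore] -/
theorem push_eq_zero_of_not_le {lo hi : Fin P.d → ℤ} (hN : ∀ κ, hi κ - lo κ < P.sitesPerDir j)
    (A : PBond P j → ℝ)
    (hA0 : ∀ b : PBond P j, (¬ ∃ y : Fin P.d → ℤ, lo ≤ y ∧ y + e b.dir ≤ hi ∧ b.src = castSite y) → A b = 0)
    {x : Fin P.d → ℤ} {μ : Fin P.d} (hxlo : lo ≤ x) (hxhi : x ≤ hi) (hin : ¬ x + e μ ≤ hi) :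
    A ⟨castSite x, μ⟩ = 0 := by
  refine hA0 _ fun ⟨y, hy, hyμ, hsrc⟩ => hin ?_
  simp only at hsrc hyμ
  rw [castSite_injOn_box hN hxlo hxhi hy (le_of_add_e_le μ hyμ) hsrc]
  exact hyμ

/-- The scalar vanishes at `(x, μ)` when `x + e_μ` leaves the box (margin row). [folklore] -/
theorem eq_zero_of_not_le {lo hi : Fin P.d → ℤ} (a : Zd P.d → Fin P.d → ℝ)
    (ha1 : ∀ x μ, a x μ ≠ 0 → lo + 1 ≤ x ∧ x + unitVec μ + 1 ≤ hi)
    {x : Fin P.d → ℤ} {μ : Fin P.d} (hin : ¬ x + e μ ≤ hi) : a x μ = 0 := by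
  by_contra hne
  apply hin
  have h2 := (ha1 x μ hne).2
  intro i
  have := h2 i
  simp only [Pi.add_apply, Pi.one_apply, e_eq_unitVec] at this ⊢
  omega

/-- ★ **Row R6 in `ℤ^d` currency (scalar)**: `Σ_{b : PBond} (A b)² = Σ_{x ∈ Π[lo,hi]} Σ_μ (a x μ)²` — bonds of the integer box sticking out of it
contribute `0` on both sides. [cite: Balaban1984PropagatorsI, (1.10) p.19] -/
theorem sum_sq_push_eq_sum_box {lo hi : Fin P.d → ℤ} (hN : ∀ κ, hi κ - lo κ < P.sitesPerDir j)
    (a : Zd P.d → Fin P.d → ℝ) (ha1 : ∀ x μ, a x μ ≠ 0 → lo + 1 ≤ x ∧ x + unitVec μ + 1 ≤ hi)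
    (A : PBond P j → ℝ)
    (hA : ∀ (x : Fin P.d → ℤ) (μ : Fin P.d), lo ≤ x → x + e μ ≤ hi → A ⟨castSite x, μ⟩ = a x μ)
    (hA0 : ∀ b : PBond P j, (¬ ∃ y : Fin P.d → ℤ, lo ≤ y ∧ y + e b.dir ≤ hi ∧ b.src = castSite y) → A b = 0) :
    ∑ b : PBond P j, A b ^ 2 = ∑ x ∈ Fintype.piFinset (fun i => Finset.Icc (lo i) (hi i)), ∑ μ : Fin P.d, a x μ ^ 2 := by
  classical
  rw [sum_pbond_eq_sum_box hN (fun b : PBond P j => A b ^ 2)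
    (fun b hb => by
      by_cases h : ∃ y : Fin P.d → ℤ, lo ≤ y ∧ y + e b.dir ≤ hi ∧ b.src = castSite y
      · exact h
      · exact absurd (by rw [hA0 b h]; ring) hb)]
  refine Finset.sum_congr rfl fun x hx => Finset.sum_congr rfl fun μ _ => ?_
  obtain ⟨hxlo, hxhi⟩ := (mem_piFinset_Icc_iff x).1 hx
  by_cases hin : x + e μ ≤ hi
  · rw [hA x μ hxlo hin]
  · rw [push_eq_zero_of_not_le hN A hA0 hxlo hxhi hin, eq_zero_of_not_le a ha1 hin]

/-- The four scalar values of a box plaquette sticking out of the box vanish, hence so does its `ℤ^d` curl (margin row). [folklore] -/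
theorem curlZ_eq_zero_of_not_le {lo hi : Fin P.d → ℤ} (a : Zd P.d → Fin P.d → ℝ)
    (ha1 : ∀ x μ, a x μ ≠ 0 → lo + 1 ≤ x ∧ x + unitVec μ + 1 ≤ hi)
    {z : Fin P.d → ℤ} {μ ν : Fin P.d} (hμν : μ ≠ ν) (hin : ¬ z + e μ + e ν ≤ hi) :
    (a (z + unitVec μ) ν - a z ν) - (a (z + unitVec ν) μ - a z μ) = 0 := by
  have key : ∀ (y : Fin P.d → ℤ) (κ : Fin P.d), z ≤ y → a y κ = 0 := by
    intro y κ hzy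
    by_contra hne
    exact hin (add_e_add_e_le_of_le hμν hzy (by
      have h2 := (ha1 y κ hne).2
      intro i; have := h2 i
      simp only [Pi.add_apply, Pi.one_apply] at this ⊢
      have h0 : 0 ≤ unitVec κ i := by rw [← e_eq_unitVec]; exact e_nonneg κ i
      omega))
  have hz : z ≤ z := le_rfl
  have hzμ : z ≤ z + unitVec μ := by rw [← e_eq_unitVec]; exact le_add_of_nonneg_right (e_nonneg μ)
  have hzν : z ≤ z + unitVec ν := by rw [← e_eq_unitVec]; exact le_add_of_nonneg_right (e_nonneg ν)
  rw [key _ ν hzμ, key _ ν hz, key _ μ hzν, key _ μ hz]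
  ring

/-- **The curl dictionary on the whole integer box**: for `lo ≤ z ≤ hi` and `μ < ν` the `slotBond` curl of the push at `⟨castSite z, μ, ν⟩` is the
`ℤ^d` curl of `a` — on box plaquettes by ✓`curl_push_of_box`, and for plaquettes sticking out of the box both vanish (margin row). [folklore] -/
theorem curl_push_eq_curlZ {lo hi : Fin P.d → ℤ} (hN : ∀ κ, hi κ - lo κ < P.sitesPerDir j)
    (a : Zd P.d → Fin P.d → ℝ) (ha1 : ∀ x μ, a x μ ≠ 0 → lo + 1 ≤ x ∧ x + unitVec μ + 1 ≤ hi)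
    (A : PBond P j → ℝ)
    (hA : ∀ (x : Fin P.d → ℤ) (μ : Fin P.d), lo ≤ x → x + e μ ≤ hi → A ⟨castSite x, μ⟩ = a x μ)
    (hA0 : ∀ b : PBond P j, (¬ ∃ y : Fin P.d → ℤ, lo ≤ y ∧ y + e b.dir ≤ hi ∧ b.src = castSite y) → A b = 0)
    {z : Fin P.d → ℤ} (hzlo : lo ≤ z) (hzhi : z ≤ hi) {μ ν : Fin P.d} (hμν : μ < ν) :
    A (slotBond (⟨castSite z, μ, ν, hμν⟩ : Plaq P j) 0) + A (slotBond (⟨castSite z, μ, ν, hμν⟩ : Plaq P j) 1) -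
        A (slotBond (⟨castSite z, μ, ν, hμν⟩ : Plaq P j) 2) - A (slotBond (⟨castSite z, μ, ν, hμν⟩ : Plaq P j) 3) =
      (a (z + unitVec μ) ν - a z ν) - (a (z + unitVec ν) μ - a z μ) := by
  by_cases hin : z + e μ + e ν ≤ hi
  · exact curl_push_of_box a A hA hμν hzlo hin
  · rw [curlZ_eq_zero_of_not_le a ha1 (ne_of_lt hμν) hin]
    refine curl_push_eq_zero_of_not_mem' a ha1 A hA hA0 _ fun hmem => hin ?_
    obtain ⟨z', hz', hz'hi, hsrc⟩ := hmem
    simp only at hsrc hz'hi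
    have hz'le : z' ≤ hi := le_of_add_e_le μ (le_of_add_e_le ν hz'hi)
    rw [castSite_injOn_box hN hzlo hzhi hz' hz'le hsrc]
    exact hz'hi

/-- ★ **THE PAIRING REINDEXING** (KNIT-PLAN P3∕P5's torus ↔ `ℤ³` dictionary for `⟨du⁰, G⟩`): for EVERY plaquette function `G`,
`Σ_{p : Plaq} (dA)_p · G p = Σ_{z ∈ Π[lo,hi]} Σ_{μ<ν} ((a(z+e_μ,ν) − a(z,ν)) − (a(z+e_ν,μ) − a(z,μ))) · G ⟨castSite z, μ, ν⟩`.
[cite: GrossCMP1983, Thm 2.2] -/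
theorem sum_curl_push_mul_eq_sum_box {lo hi : Fin P.d → ℤ} (hN : ∀ κ, hi κ - lo κ < P.sitesPerDir j)
    (a : Zd P.d → Fin P.d → ℝ) (ha1 : ∀ x μ, a x μ ≠ 0 → lo + 1 ≤ x ∧ x + unitVec μ + 1 ≤ hi)
    (A : PBond P j → ℝ)
    (hA : ∀ (x : Fin P.d → ℤ) (μ : Fin P.d), lo ≤ x → x + e μ ≤ hi → A ⟨castSite x, μ⟩ = a x μ)
    (hA0 : ∀ b : PBond P j, (¬ ∃ y : Fin P.d → ℤ, lo ≤ y ∧ y + e b.dir ≤ hi ∧ b.src = castSite y) → A b = 0)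
    (G : Plaq P j → ℝ) :
    ∑ p : Plaq P j, (A (slotBond p 0) + A (slotBond p 1) - A (slotBond p 2) - A (slotBond p 3)) * G p =
      ∑ z ∈ Fintype.piFinset (fun i => Finset.Icc (lo i) (hi i)), ∑ q : {q : Fin P.d × Fin P.d // q.1 < q.2},
        ((a (z + unitVec q.1.1) q.1.2 - a z q.1.2) - (a (z + unitVec q.1.2) q.1.1 - a z q.1.1)) *
          G ⟨castSite z, q.1.1, q.1.2, q.2⟩ := by
  classical
  have hoff := curl_push_eq_zero_of_not_mem' a ha1 A hA hA0
  rw [sum_plaq_eq_sum_box hN (fun p : Plaq P j => (A (slotBond p 0) + A (slotBond p 1) - A (slotBond p 2) - A (slotBond p 3)) * G p)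
    (fun p hp => by
      by_contra hnot
      exact hp (by rw [hoff p hnot]; ring))]
  refine Finset.sum_congr rfl fun z hz => Finset.sum_congr rfl fun q _ => ?_
  obtain ⟨hzlo, hzhi⟩ := (mem_piFinset_Icc_iff z).1 hz
  rw [curl_push_eq_curlZ hN a ha1 A hA hA0 hzlo hzhi q.2]

/-- ★ **Row R5 in `ℤ^d` currency (scalar)**: `Σ_{p : Plaq} ((dA)_p)² = Σ_{z ∈ Π[lo,hi]} Σ_{μ<ν} ((a(z+e_μ,ν) − a(z,ν)) − (a(z+e_ν,μ) − a(z,μ)))²`;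
plaquettes of the integer box sticking out of it contribute `0` on both sides by the margin row alone. [cite: Balaban1985Averaging, (5) p.18] -/
theorem sum_sq_curl_push_eq_sum_box {lo hi : Fin P.d → ℤ} (hN : ∀ κ, hi κ - lo κ < P.sitesPerDir j)
    (a : Zd P.d → Fin P.d → ℝ) (ha1 : ∀ x μ, a x μ ≠ 0 → lo + 1 ≤ x ∧ x + unitVec μ + 1 ≤ hi)
    (A : PBond P j → ℝ)
    (hA : ∀ (x : Fin P.d → ℤ) (μ : Fin P.d), lo ≤ x → x + e μ ≤ hi → A ⟨castSite x, μ⟩ = a x μ)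
    (hA0 : ∀ b : PBond P j, (¬ ∃ y : Fin P.d → ℤ, lo ≤ y ∧ y + e b.dir ≤ hi ∧ b.src = castSite y) → A b = 0) :
    ∑ p : Plaq P j, (A (slotBond p 0) + A (slotBond p 1) - A (slotBond p 2) - A (slotBond p 3)) ^ 2 =
      ∑ z ∈ Fintype.piFinset (fun i => Finset.Icc (lo i) (hi i)), ∑ q : {q : Fin P.d × Fin P.d // q.1 < q.2},
        ((a (z + unitVec q.1.1) q.1.2 - a z q.1.2) - (a (z + unitVec q.1.2) q.1.1 - a z q.1.1)) ^ 2 := by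
  simp only [sq]
  rw [sum_curl_push_mul_eq_sum_box hN a ha1 A hA hA0]
  refine Finset.sum_congr rfl fun z hz => Finset.sum_congr rfl fun q _ => ?_
  obtain ⟨hzlo, hzhi⟩ := (mem_piFinset_Icc_iff z).1 hz
  rw [curl_push_eq_curlZ hN a ha1 A hA hA0 hzlo hzhi q.2]

/-- **Row R5 against KNIT-D's all-ordered-pairs letter**: `Σ_{p : Plaq} ((dA)_p)² ≤ Σ_{z ∈ Π[lo,hi]} Σ_μ Σ_ν ((a(z+e_μ,ν) − a(z,ν)) − (a(z+e_ν,μ) − a(z,μ)))²`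
(the `μ<ν` sum is a sub-sum of the ordered double sum of squares; KNIT-D ✓`sum_sq_curl_truncated_le_far` bounds the right-hand side for every finite `B`). [folklore] -/
theorem sum_sq_curl_push_le_sum_sum_box {lo hi : Fin P.d → ℤ} (hN : ∀ κ, hi κ - lo κ < P.sitesPerDir j)
    (a : Zd P.d → Fin P.d → ℝ) (ha1 : ∀ x μ, a x μ ≠ 0 → lo + 1 ≤ x ∧ x + unitVec μ + 1 ≤ hi)
    (A : PBond P j → ℝ)
    (hA : ∀ (x : Fin P.d → ℤ) (μ : Fin P.d), lo ≤ x → x + e μ ≤ hi → A ⟨castSite x, μ⟩ = a x μ)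
    (hA0 : ∀ b : PBond P j, (¬ ∃ y : Fin P.d → ℤ, lo ≤ y ∧ y + e b.dir ≤ hi ∧ b.src = castSite y) → A b = 0) :
    ∑ p : Plaq P j, (A (slotBond p 0) + A (slotBond p 1) - A (slotBond p 2) - A (slotBond p 3)) ^ 2 ≤
      ∑ z ∈ Fintype.piFinset (fun i => Finset.Icc (lo i) (hi i)), ∑ μ : Fin P.d, ∑ ν : Fin P.d,
        ((a (z + unitVec μ) ν - a z ν) - (a (z + unitVec ν) μ - a z μ)) ^ 2 := by
  rw [sum_sq_curl_push_eq_sum_box hN a ha1 A hA hA0]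
  exact Finset.sum_le_sum fun z _ =>
    sum_subtypeLT_le_sum_sum (fun μ ν => ((a (z + unitVec μ) ν - a z ν) - (a (z + unitVec ν) μ - a z μ)) ^ 2)
      (fun μ ν => sq_nonneg _)

/-- ★★★ **THE DRESSED PUSH — `stub_linTest`'s rows R2∕R3∕R5∕R6 in the skeleton's exact letters, read in `ℤ^d` currency.**  On a NON-WRAPPING box
(`hi κ − lo κ < sitesPerDir j`), for a `ℤ^d` bond field `a` with T-PRIM's margin row (`a x μ ≠ 0 → μ ≠ 0 ∧ lo + 1 ≤ x ∧ x + e_μ + 1 ≤ hi ∧ lo₀ + 2 ≤ x₀`)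
there are a scalar torus field `u⁰` (a push of `a`) and its dressing `u α b = (u⁰ b : ℂ) • τ_α` with:
(o) the definitional row and the two reading rows (`u⁰⟨castSite x, μ⟩ = a x μ` on box bonds, `u⁰ b = 0` off them);
(R2) `∀ α b, star (u α b) = -(u α b) ∧ (u α b).trace = 0`;
(R3) `∀ α b, u α b ≠ 0 → ∃ x, lo + 1 ≤ x ∧ x + e b.dir + 1 ≤ hi ∧ b.src = castSite x ∧ lowPart b.dir (x − lo) ≠ 0` (verbatim; ✓`push_support_of_margin`);
(c) the `slotBond` curl of `u⁰` is the `ℤ^d` curl of `a` on box plaquettes and `0` off `boxPlaqs lo hi`;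
(R6) `∀ α, Σ_b ‖u α b‖_F² = 2·Σ_{x ∈ Π[lo,hi]} Σ_μ (a x μ)²`;
(R5) `∀ α, Σ_p ‖u α (slotBond p 0) + u α (slotBond p 1) − u α (slotBond p 2) − u α (slotBond p 3)‖_F² = 2·Σ_{z ∈ Π[lo,hi]} Σ_{μ<ν} ((curl a)(z,μ,ν))²`
and (R5′) `≤ 2·Σ_{z ∈ Π[lo,hi]} Σ_μ Σ_ν ((curl a)(z,μ,ν))²` (KNIT-D's ordered-pairs letter);
(P) the pairing reindexing `Σ_p (du⁰)_p · G p = Σ_{z ∈ Π[lo,hi]} Σ_{μ<ν} (curl a)(z,μ,ν) · G⟨castSite z, μ, ν⟩` for every `G`.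
[cite: Balaban1984PropagatorsI, (1.10) p.19] [cite: Balaban1985UV3, p. 260] -/
theorem exists_dressed_push {lo hi : Fin P.d → ℤ} (hd : 0 < P.d) (hN : ∀ κ, hi κ - lo κ < P.sitesPerDir j)
    (a : Zd P.d → Fin P.d → ℝ)
    (ha : ∀ x μ, a x μ ≠ 0 → μ ≠ ⟨0, hd⟩ ∧ lo + 1 ≤ x ∧ x + unitVec μ + 1 ≤ hi ∧ lo ⟨0, hd⟩ + 2 ≤ x ⟨0, hd⟩) :
    ∃ (u0 : PBond P j → ℝ) (u : Fin 3 → PBond P j → Matrix (Fin 2) (Fin 2) ℂ),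
      (∀ α b, u α b = ((u0 b : ℝ) : ℂ) • (I • pauli α)) ∧
      (∀ (x : Fin P.d → ℤ) (μ : Fin P.d), lo ≤ x → x + e μ ≤ hi → u0 ⟨castSite x, μ⟩ = a x μ) ∧
      (∀ b : PBond P j, (¬ ∃ y : Fin P.d → ℤ, lo ≤ y ∧ y + e b.dir ≤ hi ∧ b.src = castSite y) → u0 b = 0) ∧
      (∀ α b, star (u α b) = -(u α b) ∧ (u α b).trace = 0) ∧
      (∀ α b, u α b ≠ 0 → ∃ x : Fin P.d → ℤ, lo + 1 ≤ x ∧ x + e b.dir + 1 ≤ hi ∧ b.src = castSite x ∧ lowPart b.dir (x - lo) ≠ 0) ∧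
      (∀ (z : Fin P.d → ℤ) (μ ν : Fin P.d) (hμν : μ < ν), lo ≤ z → z + e μ + e ν ≤ hi →
        u0 (slotBond (⟨castSite z, μ, ν, hμν⟩ : Plaq P j) 0) + u0 (slotBond (⟨castSite z, μ, ν, hμν⟩ : Plaq P j) 1) -
          u0 (slotBond (⟨castSite z, μ, ν, hμν⟩ : Plaq P j) 2) - u0 (slotBond (⟨castSite z, μ, ν, hμν⟩ : Plaq P j) 3) =
        (a (z + unitVec μ) ν - a z ν) - (a (z + unitVec ν) μ - a z μ)) ∧
      (∀ p : Plaq P j, p ∉ boxPlaqs lo hi → u0 (slotBond p 0) + u0 (slotBond p 1) - u0 (slotBond p 2) - u0 (slotBond p 3) = 0) ∧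
      (∀ α, ∑ b : PBond P j, ‖u α b‖ ^ 2 =
        2 * ∑ x ∈ Fintype.piFinset (fun i => Finset.Icc (lo i) (hi i)), ∑ μ : Fin P.d, a x μ ^ 2) ∧
      (∀ α, ∑ p : Plaq P j, ‖u α (slotBond p 0) + u α (slotBond p 1) - u α (slotBond p 2) - u α (slotBond p 3)‖ ^ 2 =
        2 * ∑ z ∈ Fintype.piFinset (fun i => Finset.Icc (lo i) (hi i)), ∑ q : {q : Fin P.d × Fin P.d // q.1 < q.2},
          ((a (z + unitVec q.1.1) q.1.2 - a z q.1.2) - (a (z + unitVec q.1.2) q.1.1 - a z q.1.1)) ^ 2) ∧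
      (∀ α, ∑ p : Plaq P j, ‖u α (slotBond p 0) + u α (slotBond p 1) - u α (slotBond p 2) - u α (slotBond p 3)‖ ^ 2 ≤
        2 * ∑ z ∈ Fintype.piFinset (fun i => Finset.Icc (lo i) (hi i)), ∑ μ : Fin P.d, ∑ ν : Fin P.d,
          ((a (z + unitVec μ) ν - a z ν) - (a (z + unitVec ν) μ - a z μ)) ^ 2) ∧
      (∀ G : Plaq P j → ℝ,
        ∑ p : Plaq P j, (u0 (slotBond p 0) + u0 (slotBond p 1) - u0 (slotBond p 2) - u0 (slotBond p 3)) * G p =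
          ∑ z ∈ Fintype.piFinset (fun i => Finset.Icc (lo i) (hi i)), ∑ q : {q : Fin P.d × Fin P.d // q.1 < q.2},
            ((a (z + unitVec q.1.1) q.1.2 - a z q.1.2) - (a (z + unitVec q.1.2) q.1.1 - a z q.1.1)) *
              G ⟨castSite z, q.1.1, q.1.2, q.2⟩) := by
  obtain ⟨A, hA, hA0⟩ := exists_push (j := j) hN a
  have ha1 : ∀ x μ, a x μ ≠ 0 → lo + 1 ≤ x ∧ x + unitVec μ + 1 ≤ hi := fun x μ h => ⟨(ha x μ h).2.1, (ha x μ h).2.2.1⟩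
  refine ⟨A, fun α b => ((A b : ℝ) : ℂ) • (I • pauli α), fun _ _ => rfl, hA, hA0, fun α b => dress_skew_traceless A α b,
    fun α b hb => push_support_of_margin hd a ha A hA hA0 b (ne_zero_of_dress_ne_zero A α b hb),
    fun z μ ν hμν hz hzhi => curl_push_of_box a A hA hμν hz hzhi, curl_push_eq_zero_of_not_mem' a ha1 A hA hA0,
    fun α => ?_, fun α => ?_, fun α => ?_, sum_curl_push_mul_eq_sum_box hN a ha1 A hA hA0⟩
  · rw [sum_norm_sq_dress, sum_sq_push_eq_sum_box hN a ha1 A hA hA0]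
  · rw [sum_norm_sq_curl_dress, sum_sq_curl_push_eq_sum_box hN a ha1 A hA hA0]
  · rw [sum_norm_sq_curl_dress]
    exact mul_le_mul_of_nonneg_left (sum_sq_curl_push_le_sum_sum_box hN a ha1 A hA hA0) (by norm_num)

end Push

end Summit.QuantumFields.YangMills.Theorems.UnitScaleGibbsTestFieldSU2DressingPush

end
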